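import Literature.MathematicalPhysics.QuantumManyBody.PeriodicWeightedMaxFormBridge
import Literature.MathematicalPhysics.QuantumManyBody.PeriodicMaxFormPositivity
import HarnessLib

/-!
# The maximal form of `-∑ⱼΔⱼ + W` (abstract weight): the potential part as a Bochner integral and the
# first variation at a ground state

Topic `Literature/MathematicalPhysics/QuantumManyBody`, sequel of `PeriodicWeightedMaxFormBridge.lean`;
abstract-weight twin of the middle part of `PeriodicMaxFormPositivity.lean` (same statements and proofs with
`periodicInteraction v L ↦ W`, under `hWm : Measurable W`, `hW : ∫⁻ X in cellN N L, W X ≠ ⊤`).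

* `maxFormPotBW W L η ξ = ∫ (W ∘ fromUnitTorusN L) re(conj(η) ξ)` — the potential bilinear form (the kinetic
  one, `maxFormKinB`, is the pair file's);
* integrability of the weight and of `W̃|η|²`, `W̃ re(conj η ξ)` for classes of finite potential energy, and the
  expansions `maxFormPotW(η + sξ) = maxFormPotW η + 2s PotB(η, ξ) + s² maxFormPotW ξ`,
  `maxFormW(η + sξ) = maxFormW η + 2s(KinB + PotB)(η, ξ) + s² maxFormW ξ` (`toReal_maxFormW_add_smul`);
* `maxFormKinB_add_maxFormPotBW_eq` — **first variation (Euler–Lagrange) at a ground state**: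
  `KinB(η, ξ) + PotB(η, ξ) = E₀(W) re⟪η, ξ⟫` for `η ∈ maxFormGroundStatesW W L` and a Bose-symmetric direction
  `ξ` of finite maximal form [ReedSimonIV1978, Thm. XIII.1].

## References
* [ReedSimonIV1978] Reed–Simon IV, §XIII.12, Thms XIII.44–45, XIII.48; Thm XIII.1.
* [FarisSimon1975] W. Faris, B. Simon, Duke Math. J. 42 (1975) 559–567.
-/

noncomputable section

open MeasureTheory Filter Set WithLp Complex UnitAddTorus
open scoped ENNReal NNReal Topology ComplexConjugate InnerProductSpace
open Literature.Analysis.FunctionSpaces Literature.Analysis.OperatorTheory Literature.Analysis.InnerProduct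

namespace Literature.MathematicalPhysics.QuantumManyBody.BoseGas

-- The measure on `ℝ/ℤ` is the Haar PROBABILITY measure, as in `PeriodicFormDomain.lean`.
attribute [local instance] formDomain_measureSpace formDomain_isProbabilityMeasure formDomain_isProbabilityMeasure_pi

variable {N : ℕ} {L : ℝ} {W : Config N → ℝ≥0∞}

/-- Local notation for the Hilbert space `H = L²((ℝ/ℤ)^{3N})`. -/
local notation "L2T " N':max => Lp ℂ 2 (volume : Measure (UnitAddTorus (Fin N' × Fin 3)))

/-! ### The bilinear forms and the expansion of the maximal form -/


/-- **The potential bilinear form** (real part of the polarisation of `maxFormPotW`):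
`maxFormPotBW W L η ξ = ∫ (W ∘ fromUnitTorusN L) re(conj(η) ξ)`. [folklore] -/
def maxFormPotBW (W : Config N → ℝ≥0∞) (L : ℝ) (η ξ : L2T N) : ℝ :=
  ∫ t, (W (fromUnitTorusN L t)).toReal *
    (conj ((η : UnitAddTorus (Fin N × Fin 3) → ℂ) t) * (ξ : UnitAddTorus (Fin N × Fin 3) → ℂ) t).re


/-! ### The potential part as a Bochner integral -/

section Potential

/-- The transported weight is a.e. finite. [folklore] -/
theorem ae_weight_fromUnitTorusN_lt_top (hL : 0 < L) (hWm : Measurable W) (hW : ∫⁻ X in cellN N L, W X ≠ ⊤) :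
    ∀ᵐ t ∂(volume : Measure (UnitAddTorus (Fin N × Fin 3))), W (fromUnitTorusN L t) < ⊤ :=
  ae_lt_top ((measurable_weight_fromUnitTorusN hWm L))
    (lintegral_weight_fromUnitTorusN_ne_top hL hWm hW)

/-- The real weight `w = (W ∘ fromUnitTorusN L).toReal` is integrable. [folklore] -/
theorem integrable_weight_fromUnitTorusN_toReal (hL : 0 < L) (hWm : Measurable W)
    (hW : ∫⁻ X in cellN N L, W X ≠ ⊤) :
    Integrable (fun t : UnitAddTorus (Fin N × Fin 3) => (W (fromUnitTorusN L t)).toReal) volume :=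
  integrable_toReal_of_lintegral_ne_top ((measurable_weight_fromUnitTorusN hWm L)).aemeasurable
    (lintegral_weight_fromUnitTorusN_ne_top hL hWm hW)

/-- **The potential part of a class of finite potential energy is a Bochner integral**:
`w |η|²` is integrable and `(maxFormPotW W L η).toReal = ∫ w |η|²`. [folklore] -/
theorem integrable_of_maxFormPotW_ne_top (hL : 0 < L) (hWm : Measurable W)
    (hW : ∫⁻ X in cellN N L, W X ≠ ⊤) {η : L2T N} (h : maxFormPotW W L η ≠ ⊤) :
    Integrable (fun t : UnitAddTorus (Fin N × Fin 3) => (W (fromUnitTorusN L t)).toReal *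
      ‖(η : UnitAddTorus (Fin N × Fin 3) → ℂ) t‖ ^ 2) volume ∧
    (maxFormPotW W L η).toReal = ∫ t, (W (fromUnitTorusN L t)).toReal *
      ‖(η : UnitAddTorus (Fin N × Fin 3) → ℂ) t‖ ^ 2 := by
  have hpt : ∀ t : UnitAddTorus (Fin N × Fin 3), (W (fromUnitTorusN L t) *
      ((‖(η : UnitAddTorus (Fin N × Fin 3) → ℂ) t‖₊ : ℝ≥0∞)) ^ 2).toReal =
      (W (fromUnitTorusN L t)).toReal * ‖(η : UnitAddTorus (Fin N × Fin 3) → ℂ) t‖ ^ 2 := by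
    intro t
    rw [ENNReal.toReal_mul, coe_nnnorm_sq_eq_ofReal, ENNReal.toReal_ofReal (sq_nonneg _)]
  have hint := integrable_toReal_of_lintegral_ne_top (aemeasurable_weight_integrand hWm L η) h
  simp only [hpt] at hint
  refine ⟨hint, ?_⟩
  unfold maxFormPotW
  rw [← integral_toReal (aemeasurable_weight_integrand hWm L η)]
  · exact integral_congr_ae (Eventually.of_forall hpt)
  · filter_upwards [ae_weight_fromUnitTorusN_lt_top hL hWm hW] with t ht
    exact ENNReal.mul_lt_top ht (ENNReal.pow_lt_top ENNReal.coe_lt_top)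

/-- The potential bilinear integrand is integrable for classes of finite potential energy. [folklore] -/
theorem integrable_maxFormPotBW (hL : 0 < L) (hWm : Measurable W)
    (hW : ∫⁻ X in cellN N L, W X ≠ ⊤) {η ξ : L2T N} (hη : maxFormPotW W L η ≠ ⊤)
    (hξ : maxFormPotW W L ξ ≠ ⊤) :
    Integrable (fun t : UnitAddTorus (Fin N × Fin 3) => (W (fromUnitTorusN L t)).toReal *
      (conj ((η : UnitAddTorus (Fin N × Fin 3) → ℂ) t) * (ξ : UnitAddTorus (Fin N × Fin 3) → ℂ) t).re) volume := by
  refine Integrable.mono' ((integrable_of_maxFormPotW_ne_top hL hWm hW hη).1.add (integrable_of_maxFormPotW_ne_top hL hWm hW hξ).1)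
    ?_ (Eventually.of_forall fun t => ?_)
  · exact (((measurable_weight_fromUnitTorusN hWm L)).ennreal_toReal.aestronglyMeasurable).mul
      (Complex.continuous_re.comp_aestronglyMeasurable
        ((Complex.continuous_conj.comp_aestronglyMeasurable (Lp.aestronglyMeasurable η)).mul
          (Lp.aestronglyMeasurable ξ)))
  · rw [Real.norm_eq_abs, abs_mul, abs_of_nonneg ENNReal.toReal_nonneg, Pi.add_apply, ← mul_add]
    exact mul_le_mul_of_nonneg_left (abs_re_conj_mul_le _ _) ENNReal.toReal_nonneg

/-- Potential energy of a sum is finite if both summands have finite potential energy. [folklore] -/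
theorem maxFormPotW_add_ne_top (hWm : Measurable W) {η ξ : L2T N} (hη : maxFormPotW W L η ≠ ⊤)
    (hξ : maxFormPotW W L ξ ≠ ⊤) :
    maxFormPotW W L (η + ξ) ≠ ⊤ := by
  have h := maxFormPotW_parallelogram hWm L η ξ
  have hle : maxFormPotW W L (η + ξ) ≤ 2 * maxFormPotW W L η + 2 * maxFormPotW W L ξ := le_self_add.trans_eq h
  exact ne_top_of_le_ne_top (by
    exact ENNReal.add_ne_top.2 ⟨ENNReal.mul_ne_top ENNReal.ofNat_ne_top hη, ENNReal.mul_ne_top ENNReal.ofNat_ne_top hξ⟩) hle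

/-- Potential energy of a scalar multiple is finite. [folklore] -/
theorem maxFormPotW_smul_ne_top (c : ℂ) {ξ : L2T N} (hξ : maxFormPotW W L ξ ≠ ⊤) :
    maxFormPotW W L (c • ξ) ≠ ⊤ := by
  rw [maxFormPotW_smul]; exact ENNReal.mul_ne_top ENNReal.ofReal_ne_top hξ

/-- **Expansion of the potential part**: for real `s` and classes of finite potential energy,
`maxFormPotW(η + sξ) = maxFormPotW η + 2s PotB(η, ξ) + s² maxFormPotW ξ` (as real numbers). [folklore] -/
theorem toReal_maxFormPotW_add_smul (hL : 0 < L) (hWm : Measurable W)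
    (hW : ∫⁻ X in cellN N L, W X ≠ ⊤) {η ξ : L2T N} (hη : maxFormPotW W L η ≠ ⊤)
    (hξ : maxFormPotW W L ξ ≠ ⊤) (s : ℝ) :
    (maxFormPotW W L (η + (s : ℂ) • ξ)).toReal =
      (maxFormPotW W L η).toReal + 2 * s * maxFormPotBW W L η ξ + s ^ 2 * (maxFormPotW W L ξ).toReal := by
  have hfin : maxFormPotW W L (η + (s : ℂ) • ξ) ≠ ⊤ := maxFormPotW_add_ne_top hWm hη (maxFormPotW_smul_ne_top _ hξ)
  have hA : Integrable (fun t : UnitAddTorus (Fin N × Fin 3) =>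
      (W (fromUnitTorusN L t)).toReal * ‖(η : UnitAddTorus (Fin N × Fin 3) → ℂ) t‖ ^ 2) volume :=
    (integrable_of_maxFormPotW_ne_top hL hWm hW hη).1
  have hB : Integrable (fun t : UnitAddTorus (Fin N × Fin 3) =>
      2 * s * ((W (fromUnitTorusN L t)).toReal *
        (conj ((η : UnitAddTorus (Fin N × Fin 3) → ℂ) t) * (ξ : UnitAddTorus (Fin N × Fin 3) → ℂ) t).re)) volume :=
    (integrable_maxFormPotBW hL hWm hW hη hξ).const_mul _
  have hC : Integrable (fun t : UnitAddTorus (Fin N × Fin 3) =>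
      s ^ 2 * ((W (fromUnitTorusN L t)).toReal * ‖(ξ : UnitAddTorus (Fin N × Fin 3) → ℂ) t‖ ^ 2))
      volume :=
    (integrable_of_maxFormPotW_ne_top hL hWm hW hξ).1.const_mul _
  have hAB : Integrable (fun t : UnitAddTorus (Fin N × Fin 3) =>
      (W (fromUnitTorusN L t)).toReal * ‖(η : UnitAddTorus (Fin N × Fin 3) → ℂ) t‖ ^ 2 +
      2 * s * ((W (fromUnitTorusN L t)).toReal *
        (conj ((η : UnitAddTorus (Fin N × Fin 3) → ℂ) t) * (ξ : UnitAddTorus (Fin N × Fin 3) → ℂ) t).re)) volume :=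
    hA.add hB
  rw [(integrable_of_maxFormPotW_ne_top hL hWm hW hfin).2, (integrable_of_maxFormPotW_ne_top hL hWm hW hη).2,
    (integrable_of_maxFormPotW_ne_top hL hWm hW hξ).2, maxFormPotBW, ← integral_const_mul, ← integral_const_mul,
    ← integral_add hA hB, ← integral_add hAB hC]
  refine integral_congr_ae ?_
  filter_upwards [Lp.coeFn_add η ((s : ℂ) • ξ), Lp.coeFn_smul (s : ℂ) ξ] with t hadd hsmul
  rw [hadd, Pi.add_apply, hsmul, Pi.smul_apply, smul_eq_mul, norm_add_ofReal_mul_sq]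
  ring

/-- **Expansion of the maximal form** along a real line: for classes of finite maximal form,
`maxFormW(η + sξ) = maxFormW η + 2s(KinB + PotB)(η, ξ) + s² maxFormW ξ` and `maxFormW(η + sξ) < ∞`. [folklore] -/
theorem toReal_maxFormW_add_smul (hL : 0 < L) (hWm : Measurable W)
    (hW : ∫⁻ X in cellN N L, W X ≠ ⊤) {η ξ : L2T N} (hη : maxFormW W L η ≠ ⊤)
    (hξ : maxFormW W L ξ ≠ ⊤) (s : ℝ) :
    maxFormW W L (η + (s : ℂ) • ξ) ≠ ⊤ ∧
    (maxFormW W L (η + (s : ℂ) • ξ)).toReal = (maxFormW W L η).toReal +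
      2 * s * (maxFormKinB L η ξ + maxFormPotBW W L η ξ) + s ^ 2 * (maxFormW W L ξ).toReal := by
  have hηK : maxFormKin L η ≠ ⊤ := ne_top_of_le_ne_top hη (self_le_add_right _ _)
  have hξK : maxFormKin L ξ ≠ ⊤ := ne_top_of_le_ne_top hξ (self_le_add_right _ _)
  have hηP : maxFormPotW W L η ≠ ⊤ := ne_top_of_le_ne_top hη (self_le_add_left _ _)
  have hξP : maxFormPotW W L ξ ≠ ⊤ := ne_top_of_le_ne_top hξ (self_le_add_left _ _)
  have hK : maxFormKin L (η + (s : ℂ) • ξ) ≠ ⊤ := maxFormKin_add_ne_top hηK (maxFormKin_smul_ne_top _ hξK)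
  have hP : maxFormPotW W L (η + (s : ℂ) • ξ) ≠ ⊤ := maxFormPotW_add_ne_top hWm hηP (maxFormPotW_smul_ne_top _ hξP)
  refine ⟨ENNReal.add_ne_top.2 ⟨hK, hP⟩, ?_⟩
  rw [maxFormW, maxFormW, maxFormW, ENNReal.toReal_add hK hP, ENNReal.toReal_add hηK hηP, ENNReal.toReal_add hξK hξP,
    toReal_maxFormKin_add_smul hηK hξK, toReal_maxFormPotW_add_smul hL hWm hW hηP hξP]
  ring

end Potential


/-! ### The first variation of the Rayleigh quotient at a ground state -/


/-- **First variation (Euler–Lagrange equation) at a ground state of the maximal form.** For `L > 0`,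
`∫ W < ∞`, `E₀ < ∞`, a ground state `η ∈ maxFormGroundStatesW W L` and a Bose-symmetric direction `ξ` of
finite maximal form: `KinB(η, ξ) + PotB(η, ξ) = E₀ re⟪η, ξ⟫` — the weak eigenvalue equation
`q(η, ξ) = E₀ ⟪η, ξ⟫` (real part), from `E₀‖η + sξ‖² ≤ maxFormW(η + sξ)` for all real `s` with equality at
`s = 0`. [cite: ReedSimonIV1978, Thm. XIII.1] -/
theorem maxFormKinB_add_maxFormPotBW_eq (hL : 0 < L) (hWm : Measurable W)
    (hW : ∫⁻ X in cellN N L, W X ≠ ⊤) (hE : periodicGroundStateEnergyW W L ≠ ⊤)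
    {η ξ : L2T N} (hη : η ∈ maxFormGroundStatesW W L) (hξ : ξ ∈ boseSymmetric N) (hξfin : maxFormW W L ξ ≠ ⊤) :
    maxFormKinB L η ξ + maxFormPotBW W L η ξ = (periodicGroundStateEnergyW W L).toReal * (⟪η, ξ⟫_ℂ).re := by
  set E := periodicGroundStateEnergyW W L with hEdef
  have hηfin : maxFormW W L η ≠ ⊤ := maxFormW_ne_top_of_mem_maxFormGroundStatesW hE hη
  have hη0 : (maxFormW W L η).toReal = E.toReal * ‖η‖ ^ 2 := by
    rw [maxFormW_eq_of_mem_maxFormGroundStatesW hL hWm hW hη, ENNReal.toReal_mul, ENNReal.toReal_ofReal (sq_nonneg _)]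
  -- the inequality along the line `η + sξ`
  have hline : ∀ s : ℝ, E.toReal * ‖η + (s : ℂ) • ξ‖ ^ 2 ≤ (maxFormW W L (η + (s : ℂ) • ξ)).toReal := by
    intro s
    have hmem : η + (s : ℂ) • ξ ∈ boseSymmetric N := (boseSymmetric N).add_mem hη.1 ((boseSymmetric N).smul_mem _ hξ)
    have h := periodicGroundStateEnergyW_mul_le_maxFormW_of_mem hL hWm hW hmem
    have h2 := ENNReal.toReal_mono (toReal_maxFormW_add_smul hL hWm hW hηfin hξfin s).1 h
    rwa [ENNReal.toReal_mul, ENNReal.toReal_ofReal (sq_nonneg _)] at h2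
  have hpoly : ∀ s : ℝ, 0 ≤ ((maxFormW W L ξ).toReal - E.toReal * ‖ξ‖ ^ 2) * s ^ 2 +
      (2 * (maxFormKinB L η ξ + maxFormPotBW W L η ξ - E.toReal * (⟪η, ξ⟫_ℂ).re)) * s := by
    intro s
    have h := hline s
    rw [(toReal_maxFormW_add_smul hL hWm hW hηfin hξfin s).2, hη0, norm_add_ofReal_smul_sq] at h
    nlinarith [h]
  have h0 := eq_zero_of_forall_sq_add_mul_nonneg hpoly
  linarith
end Literature.MathematicalPhysics.QuantumManyBody.BoseGas

end
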